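import Summits.BirchSwinnertonDyer.BirchSwinnertonDyer.Theorems.PrintCFramAwayBinderCriterion
import HarnessLib

/-!
# Route PrintCFram, regime N: the away congruence as a DECIDABLE certificate on the prime-factor list
# of the Mordell coefficient (cell `bsd-print-cfram`, seat p4 g3; supports stmt-BirchSwinnertonDyer-20698)

HONEST FRAMING (cell `bsd-print-cfram`, run/shared/lean/pub/bsd-print-cfram/, D-0131 (2) print
tier; verbatim in every file of the seat): the cell works the partition leaf
`CornerF ∧ p ramified in the CM field K` (LADDER-BSD row K7r = B13; W-ALL row 12r) in PARTITION
currency — a leaf or a cell counts only when its theorem is in the kernel BY NAME. Nothing is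
closed here. TOOL for per-class records: the hypothesis `hcong` of
`PrintCFram.away_binder_of_mordell_model` / `bsdp_three_of_ellipticUnitIndexAtThree_of_congruences`
(p553346) quantifies over all primes; this file reduces it, for a numeral `k`, to a `decide`-able check
on the list `|k|.primeFactorsList` (Mathlib simproc `Nat.primeFactorsList_ofNat`), reading the residue
symbol through Euler's criterion in `ℕ` (b2b `GaloisImage.PadicSquareClass.euler_flag_iff`). One
theorem; no definition; no named fact. beyond-print: NO.
-/

set_option linter.dupNamespace false
set_option autoImplicit false

open Literature.NumberTheory.EllipticCurves Summit.BirchSwinnertonDyer.Rank1Residual.GaloisImage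

namespace Summit.BirchSwinnertonDyer.BirchSwinnertonDyer.Theorems.PrintCFram

/-- **The away congruence from a prime-factor list (certificate form).** For `k ≠ 0` with
`|k|.primeFactorsList = L` (computed by `simp`'s `Nat.primeFactorsList_ofNat`), the away congruence of
`away_binder_of_mordell_model` — «for every prime `ℓ ≡ 1 (mod 3)` dividing `k`: `v_ℓ(k)` odd or
`k/ℓ^{v_ℓ(k)}` a non-residue mod `ℓ`» — follows from the DECIDABLE check on `L`: for every `ℓ ∈ L` with
`ℓ ≡ 1 (mod 3)`, the multiplicity of `ℓ` in `L` is odd or Euler's power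
`((k/ℓ^v mod ℓ)^{(ℓ−1)/2}) mod ℓ ≠ 1` (`PadicSquareClass.euler_flag_iff`). Per class: `by decide`.
[cite: Serre1973, Ch. II §3.3 Thm 3] [cite: HardyWright2008, Thm 83 (Euler's criterion)] -/
theorem away_congruence_of_primeFactorsList {k : ℤ} (hk : k ≠ 0) {L : List ℕ}
    (hL : k.natAbs.primeFactorsList = L)
    (hcheck : ∀ ℓ ∈ L, ℓ % 3 = 1 →
      L.count ℓ % 2 = 1 ∨ (k / (ℓ : ℤ) ^ L.count ℓ % (ℓ : ℤ)).toNat ^ (ℓ / 2) % ℓ ≠ 1) :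
    ∀ ℓ : ℕ, ℓ.Prime → (ℓ : ℤ) ∣ k → ℓ % 3 = 1 →
      Odd (padicValInt ℓ k) ∨ ¬ IsSquare (((k / (ℓ : ℤ) ^ padicValInt ℓ k : ℤ)) : ZMod ℓ) := by
  intro ℓ hℓ hℓk h1
  haveI : Fact ℓ.Prime := ⟨hℓ⟩
  have hk' : k.natAbs ≠ 0 := Int.natAbs_ne_zero.mpr hk
  have hmem : ℓ ∈ L := by
    rw [← hL, Nat.mem_primeFactorsList hk']
    exact ⟨hℓ, Int.natCast_dvd.mp hℓk⟩
  have hcount : L.count ℓ = padicValInt ℓ k := by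
    rw [← hL, Nat.primeFactorsList_count_eq, Nat.factorization_def _ hℓ, padicValInt]
  rcases hcheck ℓ hmem h1 with hodd | hflag
  · left
    rw [← hcount]
    exact Nat.odd_iff.mpr hodd
  · right
    rw [← hcount]
    -- unit part `u = k / ℓ^v` is prime to `ℓ`
    set v := L.count ℓ with hv
    have hvk : (ℓ : ℤ) ^ v ∣ k := by rw [hcount]; exact padicValInt_dvd k
    obtain ⟨u, hu⟩ := hvk
    have hℓ0 : (ℓ : ℤ) ≠ 0 := by exact_mod_cast hℓ.ne_zero
    have hdiv : k / (ℓ : ℤ) ^ v = u := by rw [hu, Int.mul_ediv_cancel_left _ (pow_ne_zero _ hℓ0)]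
    have hℓu : ¬ (ℓ : ℤ) ∣ u := by
      rintro ⟨u', rfl⟩
      have hdvd : (ℓ : ℤ) ^ (v + 1) ∣ k := ⟨u', by rw [hu]; ring⟩
      rcases (padicValInt_dvd_iff (p := ℓ) (v + 1) k).mp hdvd with h | h
      · exact hk h
      · rw [← hcount] at h; omega
    rw [hdiv] at hflag ⊢
    intro hsq
    have := (PadicSquareClass.euler_flag_iff (p := ℓ) hℓu).mpr hsq
    rw [beq_iff_eq] at this
    exact hflag this

end Summit.BirchSwinnertonDyer.BirchSwinnertonDyer.Theorems.PrintCFram
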